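/-
Origin: expansion seat `planner-pub-hodgecm-pv12-g6-0`, handover #7 2026-08-18T08:45:41Z (`HOME/pub-hodgecm-pv12-g6/lean/Pv12g6/FockPrintLocalFock.lean`, md5 fc83e420, 188 lines);
landed by the gen-7 packager in gate run 27 as `HodgeCM/PerL34/FockPrintLocalFock.lean` (import ^import Pv[0-9]+g[0-9]+\.→import HodgeCM.PerL34. ×1).
-/
/-
Copyright (c) 2026. Released under the Apache-2.0 license.
-/
import Summits.HodgeConjecture.HodgeCM.PerL34.ArchCFock_2
import Mathlib.Analysis.Complex.Circle
import Summits.HodgeConjecture.HodgeCM.PerL34.FockPrintKappaPart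

/-!
# `ArchCFock.LocalFock.ofM` with the operator family FROM PRINT (junction, by name)

Origin: expansion seat `planner-pub-hodgecm-pv12-g6-0` (unit `pub-hodgecm-pv12-g6`, DAG-node prover #12 gen 6,
the Fock-model seat).  WIP module `Pv12g6.FockPrintLocalFock`; intended final place
`HodgeCM/PerL34/FockPrintLocalFock.lean`; imports the TREE file `HodgeCM.PerL34.ArchCFock` (pv12-g2) and
`HodgeCM.PerL34.FockPrintKappaPart` (this seat).  Asserts nothing: no new constants, no `axiom`, complete proofs;
pv12-g2's constructor `LocalFock.ofM` is CALLED, nothing restated.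

`LocalFock.ofM` builds the local N28 datum at `b ∈ Σ₁₂` from an ARBITRARY operator family `X` on `ℂ[P]` one member
of which is a raising operator `c_b·(P·_)`, `c_b ≠ 0` (its field `X` = "[SETUP D5] ω_{W,b}(X_k) on the κ_b-part",
an INPUT).  `LocalFock.ofPrintM` supplies that input FROM PRINT: `X := printedU11M λ` = Adams's Fock operators of
the matrix units `E_{ij}` of `𝔲(W_b)_ℂ = 𝔲(1,1)_ℂ = 𝔤𝔩₂` restricted to `ℂ[P]` (`FockPrintKappaPart`), raising
member `(0,1)`, `c_b = i/λ`.  In `ofPrintM` the torus data `(T, vac, π, hπ)` stay pv12-g2's parameters (group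
level, [SETUP D4/D5]); in `ofPrintMScaled` the torus is `ℂˣ × ℂˣ ⊃ U(1) × U(1)` acting by the kernel monomial
scaling `scalePi` times a vacuum character `vac`, which is then the ONLY remaining input (D5 / N26, PRINT).
The same at the place type `D₁₂` (both lines of one sign, κ_b-part the line `ℂ·1`): `ofPrintEScaled` calls
pv12-g2's `LocalFock.ofE` with the printed `𝔲(2)_ℂ` family `printedU2E λ` and `vac t • scalePiE t`.
The [SETUP D4] data proper use the COMPACT torus `T_b = U(W_{1,b}) × U(W_{2,b}) = U(1) × U(1)` (Mathlib
`Circle × Circle`, embedded by `Circle.toUnits`): `ofPrintMCircle`, `ofPrintECircle` (adv2g19-O5; the `ℂˣ × ℂˣ`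
versions are their complexification and are not advertised as the D4 datum).
Labels: KERNEL throughout; PRINT residue as in `FockPrintDictionary` (P1)(P3), unchanged.
-/

set_option autoImplicit false

namespace HodgeCM
namespace PerL34
namespace Fock
namespace PrintDict

open Complex

/-- **`LocalFock` at `b ∈ Σ₁₂` with the operator family FROM PRINT (KERNEL junction)**: pv12-g2's
`LocalFock.ofM` called with `X :=` the printed `𝔲(1,1)_ℂ` family `printedU11M λ` (index type `Fin 2 × Fin 2`, the
matrix units `E_{ij}` of `𝔤𝔩₂`), raising member `(0,1)`, `c_b = i/λ ≠ 0`.  The torus data `(T, vac, π, hπ)` are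
pv12-g2's parameters, unchanged (group level, [SETUP D4/D5]). -/
noncomputable def LocalFock.ofPrintM (lam : ℂ) (hlam : lam ≠ 0) (T : Type) [Group T] (vac : T → ℂ)
    (π : T → (MixedModel →ₐ[ℂ] MixedModel)) (hπ : ∀ t, ∀ f ∈ kappaPartM, (π t).toLinearMap f ∈ kappaPartM) :
    LocalFock :=
  LocalFock.ofM (printedU11M lam) (I * lam⁻¹) (mul_ne_zero I_ne_zero (inv_ne_zero hlam)) (0, 1)
    (printedU11M_raise lam) T vac π hπ

/-- The fields of `ofPrintM` are the intended ones (bookkeeping, all `rfl`). -/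
theorem LocalFock.ofPrintM_X (lam : ℂ) (hlam : lam ≠ 0) (T : Type) [Group T] (vac : T → ℂ)
    (π : T → (MixedModel →ₐ[ℂ] MixedModel)) (hπ : ∀ t, ∀ f ∈ kappaPartM, (π t).toLinearMap f ∈ kappaPartM) :
    (LocalFock.ofPrintM lam hlam T vac π hπ).M = ↥kappaPartM ∧
      (LocalFock.ofPrintM lam hlam T vac π hπ).ι = (Fin 2 × Fin 2) ∧
      HEq (LocalFock.ofPrintM lam hlam T vac π hπ).X (printedU11M lam) ∧
      HEq (LocalFock.ofPrintM lam hlam T vac π hπ).φ (⟨1, one_mem_kappaPartM⟩ : ↥kappaPartM) :=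
  ⟨rfl, rfl, HEq.rfl, HEq.rfl⟩

/-- Non-degeneracy witness for `ofPrintM` (as pv12-g2's `ofM_nondeg`): `φ⁰_b = 1` is detected by the constant
coefficient. -/
theorem LocalFock.ofPrintM_nondeg (lam : ℂ) (hlam : lam ≠ 0) (T : Type) [Group T] (vac : T → ℂ)
    (π : T → (MixedModel →ₐ[ℂ] MixedModel)) (hπ : ∀ t, ∀ f ∈ kappaPartM, (π t).toLinearMap f ∈ kappaPartM) :
    ∃ ℓ : (LocalFock.ofPrintM lam hlam T vac π hπ).M →ₗ[ℂ] ℂ, ℓ (LocalFock.ofPrintM lam hlam T vac π hπ).φ ≠ 0 := by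
  refine ⟨(MvPolynomial.lcoeff ℂ 0).comp kappaPartM.subtype, ?_⟩
  show MvPolynomial.lcoeff ℂ 0 (1 : MixedModel) ≠ 0
  rw [MvPolynomial.lcoeff_apply, MvPolynomial.coeff_zero_one]
  exact one_ne_zero

/-! ### With the torus scaling from the kernel too: the vacuum character is the only remaining input -/

/-- **`LocalFock` at `b ∈ Σ₁₂` with operator family AND torus scaling from the kernel, COMPLEXIFIED torus**
(`T := ℂˣ × ℂˣ`; this is NOT the [SETUP D4] datum, whose torus is the compact `U(1) × U(1)` — that is
`ofPrintMCircle` below, adv2g19-O5): `X := printedU11M λ` (print), `ω t := vac t • π t`, `π t = scalePi t` the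
monomial scaling
`f(z,w) ↦ f(t₁z, t₂⁻¹w)` (`FockPrintKappaPart.scalePi`, preserving `ℂ[P]`: `scalePi_mem_kappaPartM`).  The ONE
remaining parameter is the vacuum character `vac : ℂˣ × ℂˣ → ℂ` (dictionary D5 / node N26: `det^{±3/2}` on the
metaplectic cover in Adams's normalisation [Ad07 chunk p0023 L22], trivial after PerL's untwisting — PRINT/INPUT). -/
noncomputable def LocalFock.ofPrintMScaled (lam : ℂ) (hlam : lam ≠ 0) (vac : ℂˣ × ℂˣ → ℂ) : LocalFock :=
  LocalFock.ofPrintM lam hlam (ℂˣ × ℂˣ) vac scalePi scalePi_mem_kappaPartM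

/-- (Ported verbatim from the HodgeCMPerL package; no docstring in the source.) -/
theorem LocalFock.ofPrintMScaled_fields (lam : ℂ) (hlam : lam ≠ 0) (vac : ℂˣ × ℂˣ → ℂ) :
    (LocalFock.ofPrintMScaled lam hlam vac).M = ↥kappaPartM ∧
      (LocalFock.ofPrintMScaled lam hlam vac).T = (ℂˣ × ℂˣ) ∧
      HEq (LocalFock.ofPrintMScaled lam hlam vac).X (printedU11M lam) ∧
      HEq (LocalFock.ofPrintMScaled lam hlam vac).χ vac :=
  ⟨rfl, rfl, HEq.rfl, HEq.rfl⟩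

/-- The torus acts on `P^k ∈ ℂ[P]` through `ofPrintMScaled` by `vac t · (t₁t₂⁻¹)^k` (KERNEL): polynomial weight
`(k, −k)` times the vacuum character — the group-level form of the printed weights `±(k + 3/2)`. -/
theorem LocalFock.ofPrintMScaled_omega_P_pow (vac : ℂˣ × ℂˣ → ℂ) (t : ℂˣ × ℂˣ) (k : ℕ) :
    (((vac t • (scalePi t).toLinearMap.restrict (scalePi_mem_kappaPartM t))
        ⟨P ^ k, P_pow_mem_kappaPartM k⟩ : ↥kappaPartM) : MixedModel) =
      (vac t * ((t.1 : ℂ) * ((t.2⁻¹ : ℂˣ) : ℂ)) ^ k) • P ^ k := by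
  rw [LinearMap.smul_apply, Submodule.coe_smul, LinearMap.restrict_apply, Submodule.coe_mk,
    AlgHom.toLinearMap_apply, scalePi_P_pow, smul_smul]

/-- (Ported verbatim from the HodgeCMPerL package; no docstring in the source.) -/
theorem LocalFock.ofPrintMScaled_nondeg (lam : ℂ) (hlam : lam ≠ 0) (vac : ℂˣ × ℂˣ → ℂ) :
    ∃ ℓ : (LocalFock.ofPrintMScaled lam hlam vac).M →ₗ[ℂ] ℂ, ℓ (LocalFock.ofPrintMScaled lam hlam vac).φ ≠ 0 :=
  LocalFock.ofPrintM_nondeg lam hlam _ vac scalePi scalePi_mem_kappaPartM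

/-! ### The place type `D₁₂`: `LocalFock.ofE` with the printed `𝔲(2)_ℂ` and the kernel scaling -/

/-- **`LocalFock` at `b ∈ D₁₂` with operator family from print and torus scaling from the kernel, COMPLEXIFIED
torus** (`ℂˣ × ℂˣ`; the [SETUP D4] compact version is `ofPrintECircle` below): pv12-g2's
`LocalFock.ofE` (κ_b-part the line `ℂ·1 ⊂ ℂ[M_{3×2}]`) called with `X := printedU2E λ` (the printed `𝔲(2)_ℂ = 𝔤𝔩₂`
matrix units, acting on `φ⁰_b = 1` by `(3/2)δ_{jj'}`: `printedU2_one`) and `ω t := vac t • scalePiE t` on the line,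
`t ∈ ℂˣ × ℂˣ ⊃ U(W_{1,b}) × U(W_{2,b})`; the scaling fixes `1`, so the character `χ` of the datum is `vac` itself
(`ofPrintEScaled_omega`).  The vacuum character `vac` (D5 / N26: `det^{3/2}` in Adams's normalisation
[Ad07 chunk p0023 L22], trivialised by PerL's splitting characters — PRINT/INPUT) is the only parameter. -/
noncomputable def LocalFock.ofPrintEScaled (lam : ℂ) (vac : ℂˣ × ℂˣ → ℂ) : LocalFock :=
  LocalFock.ofE (printedU2E lam) (ℂˣ × ℂˣ)
    fun t => vac t • (scalePiE t).toLinearMap.restrict (scalePiE_mem_kappaPartE t)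

/-- (Ported verbatim from the HodgeCMPerL package; no docstring in the source.) -/
theorem LocalFock.ofPrintEScaled_fields (lam : ℂ) (vac : ℂˣ × ℂˣ → ℂ) :
    (LocalFock.ofPrintEScaled lam vac).M = ↥kappaPartE ∧ (LocalFock.ofPrintEScaled lam vac).T = (ℂˣ × ℂˣ) ∧
      HEq (LocalFock.ofPrintEScaled lam vac).X (printedU2E lam) :=
  ⟨rfl, rfl, HEq.rfl⟩

/-- The torus acts on the κ_b-part `ℂ·1` at `D₁₂` by the vacuum character alone (KERNEL: the scaling fixes `1`). -/
theorem LocalFock.ofPrintEScaled_omega (vac : ℂˣ × ℂˣ → ℂ) (t : ℂˣ × ℂˣ) (φ : ↥kappaPartE) :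
    (vac t • (scalePiE t).toLinearMap.restrict (scalePiE_mem_kappaPartE t)) φ = vac t • φ := by
  rw [LinearMap.smul_apply, scalePiE_restrict_eq]

/-- The printed `𝔲(2)_ℂ` acts on `φ⁰_b = 1 ∈ ℂ·1` by the infinitesimal character `E_{jj'} ↦ (3/2)δ_{jj'}`, i.e.
`B ↦ (3/2) tr B = d(det^{3/2})` (KERNEL, `printedU2_one`; Prop. 6.6 at `D₁₂` with `σ` trivial: `τ′ = (3/2, 3/2)`). -/
theorem LocalFock.ofPrintEScaled_X_vacuum (lam : ℂ) (j j' : Fin 2) :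
    ((printedU2E lam (j, j') ⟨1, Submodule.mem_span_singleton_self (1 : EqModel)⟩ : ↥kappaPartE) : EqModel) =
      ((3 / 2 : ℂ) * (if j = j' then 1 else 0)) • (1 : EqModel) := by
  rw [printedU2E_coe, printedU2_one]

/-! ### The COMPACT torus `T_b = U(W_{1,b}) × U(W_{2,b}) = U(1) × U(1)` ([SETUP D4]; adv2g19-O5) -/

/-- `U(1) × U(1) ↪ ℂˣ × ℂˣ` (Mathlib `Circle.toUnits`). -/
noncomputable def circleUnits (t : Circle × Circle) : ℂˣ × ℂˣ := (Circle.toUnits t.1, Circle.toUnits t.2)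

/-- (Ported verbatim from the HodgeCMPerL package; no docstring in the source.) -/
@[simp] theorem circleUnits_fst_coe (t : Circle × Circle) : ((circleUnits t).1 : ℂ) = (t.1 : ℂ) := rfl
/-- (Ported verbatim from the HodgeCMPerL package; no docstring in the source.) -/
@[simp] theorem circleUnits_snd_coe (t : Circle × Circle) : ((circleUnits t).2 : ℂ) = (t.2 : ℂ) := rfl

/-- **`LocalFock` at `b ∈ Σ₁₂` over the COMPACT torus** ([SETUP D4] `T_b = U(W_{1,b}) × U(W_{2,b})`, here
`Circle × Circle`; answering adv2g19-O5: `ofPrintMScaled` above is the complexified torus and is NOT the D4 datum):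
`X := printedU11M λ` (print), `ω t := vac t • scalePi (t₁, t₂)` with `|t₁| = |t₂| = 1` (kernel scaling
`f(z,w) ↦ f(t₁z, t₂⁻¹w)`), `vac : U(1) × U(1) → ℂ` the vacuum character (D5 / N26, PRINT/INPUT — the one parameter). -/
noncomputable def LocalFock.ofPrintMCircle (lam : ℂ) (hlam : lam ≠ 0) (vac : Circle × Circle → ℂ) : LocalFock :=
  LocalFock.ofPrintM lam hlam (Circle × Circle) vac (fun t => scalePi (circleUnits t))
    fun t => scalePi_mem_kappaPartM (circleUnits t)

/-- (Ported verbatim from the HodgeCMPerL package; no docstring in the source.) -/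
theorem LocalFock.ofPrintMCircle_fields (lam : ℂ) (hlam : lam ≠ 0) (vac : Circle × Circle → ℂ) :
    (LocalFock.ofPrintMCircle lam hlam vac).M = ↥kappaPartM ∧
      (LocalFock.ofPrintMCircle lam hlam vac).T = (Circle × Circle) ∧
      HEq (LocalFock.ofPrintMCircle lam hlam vac).X (printedU11M lam) ∧
      HEq (LocalFock.ofPrintMCircle lam hlam vac).χ vac :=
  ⟨rfl, rfl, HEq.rfl, HEq.rfl⟩

/-- On `P^k` the compact torus acts by `vac t · (t₁ t̄₂)^k` (KERNEL; `t₂⁻¹ = t̄₂` on `U(1)`): a unitary polynomial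
weight `(k, −k)` times the vacuum character. -/
theorem LocalFock.ofPrintMCircle_omega_P_pow (vac : Circle × Circle → ℂ) (t : Circle × Circle) (k : ℕ) :
    (((vac t • (scalePi (circleUnits t)).toLinearMap.restrict (scalePi_mem_kappaPartM (circleUnits t)))
        ⟨P ^ k, P_pow_mem_kappaPartM k⟩ : ↥kappaPartM) : MixedModel) =
      (vac t * ((t.1 : ℂ) * (t.2 : ℂ)⁻¹) ^ k) • P ^ k := by
  rw [LinearMap.smul_apply, Submodule.coe_smul, LinearMap.restrict_apply, Submodule.coe_mk,
    AlgHom.toLinearMap_apply, scalePi_P_pow, smul_smul, Units.val_inv_eq_inv_val, circleUnits_fst_coe,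
    circleUnits_snd_coe]

/-- (Ported verbatim from the HodgeCMPerL package; no docstring in the source.) -/
theorem LocalFock.ofPrintMCircle_nondeg (lam : ℂ) (hlam : lam ≠ 0) (vac : Circle × Circle → ℂ) :
    ∃ ℓ : (LocalFock.ofPrintMCircle lam hlam vac).M →ₗ[ℂ] ℂ, ℓ (LocalFock.ofPrintMCircle lam hlam vac).φ ≠ 0 :=
  LocalFock.ofPrintM_nondeg lam hlam _ vac _ _

/-- **`LocalFock` at `b ∈ D₁₂` over the COMPACT torus** `U(1) × U(1) ⊂ U(W_b) = U(2)`: `X := printedU2E λ`,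
`ω t := vac t • scalePiE (t₁, t₂)` (fixing the line `ℂ·1`), `vac` the one parameter. -/
noncomputable def LocalFock.ofPrintECircle (lam : ℂ) (vac : Circle × Circle → ℂ) : LocalFock :=
  LocalFock.ofE (printedU2E lam) (Circle × Circle)
    fun t => vac t • (scalePiE (circleUnits t)).toLinearMap.restrict (scalePiE_mem_kappaPartE (circleUnits t))

/-- (Ported verbatim from the HodgeCMPerL package; no docstring in the source.) -/
theorem LocalFock.ofPrintECircle_fields (lam : ℂ) (vac : Circle × Circle → ℂ) :
    (LocalFock.ofPrintECircle lam vac).M = ↥kappaPartE ∧ (LocalFock.ofPrintECircle lam vac).T = (Circle × Circle) ∧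
      HEq (LocalFock.ofPrintECircle lam vac).X (printedU2E lam) :=
  ⟨rfl, rfl, HEq.rfl⟩

/-- (Ported verbatim from the HodgeCMPerL package; no docstring in the source.) -/
theorem LocalFock.ofPrintECircle_omega (vac : Circle × Circle → ℂ) (t : Circle × Circle) (φ : ↥kappaPartE) :
    (vac t • (scalePiE (circleUnits t)).toLinearMap.restrict (scalePiE_mem_kappaPartE (circleUnits t))) φ =
      vac t • φ := by
  rw [LinearMap.smul_apply, scalePiE_restrict_eq]

end PrintDict
end Fock
end PerL34
end HodgeCM
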